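import Mathlib.RingTheory.Flat.Stability
import Mathlib.RingTheory.Ideal.GoingDown
import Mathlib.RingTheory.TensorProduct.MvPolynomial
import Mathlib.FieldTheory.IsAlgClosed.AlgebraicClosure
import Literature.RingTheory.MvPolynomial.GeomComponentCount
import Literature.FieldTheory.Regular.RegularBaseChange
import Literature.FieldTheory.Regular.AlgClosedTensorDomain
import HarnessLib

/-!
# Minimal primes of `I K[X_σ]` under extension of the coefficient field

Let `k ⊆ K` be a field extension, `I ⊆ k[X_σ]` an ideal and `I K[X_σ]` its extension.

* `Literature.RingTheory.MvPolynomial.comap_mem_minimalPrimes_of_mem_minimalPrimes_map` — every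
  minimal prime of `I K[X_σ]` contracts to a minimal prime of `I` (going down for the flat
  extension `k[X_σ] → K[X_σ]`; Görtz–Wedhorn, *Algebraic Geometry I*, 2nd ed., Cor. 5.45 (1) with
  Lemma 14.9: `X_K → X` is flat and surjective, so generic points of `X_K` map to generic points
  of `X`).

For `K` ALGEBRAICALLY CLOSED and any further extension `L ⊇ K`:

* `Literature.RingTheory.MvPolynomial.isPrime_map_of_isAlgClosed` — a prime `Q ⊆ K[X_σ]` stays
  prime in `L[X_σ]` (`L[X]/Q L[X] ≅ L ⊗_K K[X]/Q` is a domain: over an algebraically closed field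
  the tensor product of domains is a domain, tree
  `Literature.FieldTheory.Regular.isDomain_tensorProduct_of_isAlgClosed`; Görtz–Wedhorn
  Prop. 5.51 (ii): integral schemes over an algebraically closed field are geometrically integral);
* `Literature.RingTheory.MvPolynomial.minimalPrimes_map_of_isAlgClosed` — `Q ↦ Q L[X_σ]` is a
  bijection from the minimal primes of `J ⊆ K[X_σ]` onto those of `J L[X_σ]`, with inverse the
  contraction; hence `ncard_minimalPrimes_map_of_isAlgClosed` (same number of irreducible
  components) and `geomComponentCount_eq_ncard_minimalPrimes_map`: **the geometric number of
  irreducible components may be computed over ANY algebraically closed extension of `k`**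
  (Görtz–Wedhorn Rem. 5.55 — the independence statement recorded as "not here" in
  `GeomComponentCount.lean`);
* `Literature.RingTheory.MvPolynomial.existsUnique_minimalPrimes_map_le_ker_iff` — for a point
  `y ∈ K^σ`, "exactly one irreducible component of `V(J)_L` passes through `y`" does not depend on
  the algebraically closed field `L ⊇ K` in which it is tested.

## References
* M. F. Atiyah, I. G. Macdonald, *Introduction to Commutative Algebra*, Addison-Wesley 1969,
  Chapter 3, Exercise 16 (faithfully flat: `𝔞ᵉᶜ = 𝔞`). [AtiyahMacdonald1969]
* U. Görtz, T. Wedhorn, *Algebraic Geometry I: Schemes*, 2nd ed., Springer 2020, Cor. 5.45,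
  Prop. 5.51, Rem. 5.55, Lemma 14.9. [GortzWedhorn2020]
* Q. Liu, *Algebraic Geometry and Arithmetic Curves*, OUP 2002, §3.2.2 (Prop. 2.7, Ex. 2.12–2.14).
-/

noncomputable section

open MvPolynomial
open scoped TensorProduct

namespace Literature.RingTheory.MvPolynomial

variable {k : Type*} [Field k] {K : Type*} [Field K] [Algebra k K] {σ : Type*}

/-! ### Any extension of the coefficient field: contraction -/

/-- `I K[X] ∩ k[X] = I` for every ideal `I ⊆ k[X_σ]` and every field extension `K/k`
(`K[X]` is free, hence faithfully flat, over `k[X]`, and `𝔞ᵉᶜ = 𝔞` along a faithfully flat ring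
map; tree `Literature.FieldTheory.Regular.map_mem_map_iff`).
[cite: AtiyahMacdonald1969, Chapter 3, Exercise 16] -/
theorem comap_map_coeff_eq (I : Ideal (MvPolynomial σ k)) :
    (I.map (MvPolynomial.map (algebraMap k K))).comap (MvPolynomial.map (algebraMap k K)) = I := by
  ext p
  rw [Ideal.mem_comap, Literature.FieldTheory.Regular.map_mem_map_iff]

/-- Extension of ideals along the faithfully flat `k[X_σ] → K[X_σ]` is injective (`𝔞ᵉᶜ = 𝔞`).
[cite: AtiyahMacdonald1969, Chapter 3, Exercise 16] -/
theorem map_coeff_injective :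
    Function.Injective
      (Ideal.map (MvPolynomial.map (algebraMap k K)) :
        Ideal (MvPolynomial σ k) → Ideal (MvPolynomial σ K)) := by
  intro I J h
  rw [← comap_map_coeff_eq (K := K) I, ← comap_map_coeff_eq (K := K) J, h]

/-- **Minimal primes of `I K[X_σ]` contract to minimal primes of `I`.** If `Q` is a minimal prime
ideal over `I K[X_σ]`, then `Q ∩ k[X_σ]` is a minimal prime ideal over `I`: it is prime and
contains `I`, and if `q ⊆ Q ∩ k[X]` is a prime containing `I`, going down for the flat
(indeed free) extension `k[X] → K[X]` produces a prime `P ⊆ Q` over `q`, which contains `I K[X]`,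
so `P = Q` by minimality and `q = Q ∩ k[X]`. [cite: GortzWedhorn2020, Cor. 5.45 and Lemma 14.9] -/
theorem comap_mem_minimalPrimes_of_mem_minimalPrimes_map (I : Ideal (MvPolynomial σ k))
    {Q : Ideal (MvPolynomial σ K)}
    (hQ : Q ∈ (I.map (MvPolynomial.map (algebraMap k K))).minimalPrimes) :
    Q.comap (MvPolynomial.map (algebraMap k K)) ∈ I.minimalPrimes := by
  letI : Algebra (MvPolynomial σ k) (MvPolynomial σ K) := MvPolynomial.algebraMvPolynomial
  haveI : Module.Flat (MvPolynomial σ k) (MvPolynomial σ K) :=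
    Module.Flat.isBaseChange (R := k) (S := MvPolynomial σ k) (M := K) (MvPolynomial σ K)
      (Algebra.IsPushout.out (R := k) (S := MvPolynomial σ k) (R' := K) (S' := MvPolynomial σ K))
  haveI hQp : Q.IsPrime := hQ.1.1
  have halg : algebraMap (MvPolynomial σ k) (MvPolynomial σ K) = MvPolynomial.map (algebraMap k K) :=
    rfl
  refine ⟨⟨Ideal.comap_isPrime _ Q, Ideal.map_le_iff_le_comap.1 hQ.1.2⟩, ?_⟩
  rintro q ⟨hq, hIq⟩ hqQ
  haveI := hq
  haveI : Q.LiesOver (Q.comap (MvPolynomial.map (algebraMap k K))) := ⟨by rw [Ideal.under_def, halg]⟩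
  obtain ⟨P, hPQ, hP, hPq⟩ :=
    Ideal.exists_ideal_le_liesOver_of_le (p := q) (q := Q.comap (MvPolynomial.map (algebraMap k K)))
      Q hqQ
  have hqP : q = P.comap (MvPolynomial.map (algebraMap k K)) := by
    rw [hPq.over, Ideal.under_def, halg]
  have hIP : I.map (MvPolynomial.map (algebraMap k K)) ≤ P :=
    Ideal.map_le_iff_le_comap.2 (hqP ▸ hIq)
  have hPeq : P = Q := le_antisymm hPQ (hQ.2 ⟨hP, hIP⟩ hPQ)
  rw [hqP, hPeq]

/-- In particular the minimal primes over `𝔭 K[X_σ]`, for a PRIME `𝔭 ⊆ k[X_σ]`, all lie over `𝔭`.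
[cite: GortzWedhorn2020, Cor. 5.45 and Lemma 14.9] -/
theorem comap_eq_of_mem_minimalPrimes_map (𝔭 : Ideal (MvPolynomial σ k)) [𝔭.IsPrime]
    {Q : Ideal (MvPolynomial σ K)}
    (hQ : Q ∈ (𝔭.map (MvPolynomial.map (algebraMap k K))).minimalPrimes) :
    Q.comap (MvPolynomial.map (algebraMap k K)) = 𝔭 := by
  have h := comap_mem_minimalPrimes_of_mem_minimalPrimes_map 𝔭 hQ
  rwa [Ideal.minimalPrimes_eq_subsingleton_self, Set.mem_singleton_iff] at h

/-- A minimal prime `Q` over `I K[X_σ]` is also a minimal prime over `𝔭 K[X_σ]` for its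
contraction `𝔭 = Q ∩ k[X_σ]` (the generic point of a component of `X_K` is a generic point of its
image component in `V(𝔭)_K`). [cite: GortzWedhorn2020, Cor. 5.45] -/
theorem mem_minimalPrimes_map_comap_of_mem_minimalPrimes_map (I : Ideal (MvPolynomial σ k))
    {Q : Ideal (MvPolynomial σ K)}
    (hQ : Q ∈ (I.map (MvPolynomial.map (algebraMap k K))).minimalPrimes) :
    Q ∈ ((Q.comap (MvPolynomial.map (algebraMap k K))).map
      (MvPolynomial.map (algebraMap k K))).minimalPrimes := by
  haveI : Q.IsPrime := hQ.1.1
  refine ⟨⟨hQ.1.1, Ideal.map_comap_le⟩, fun P ⟨hP, hle⟩ hPQ => hQ.2 ⟨hP, le_trans ?_ hle⟩ hPQ⟩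
  exact Ideal.map_mono (Ideal.map_le_iff_le_comap.1 hQ.1.2)

/-! ### Algebraically closed coefficient field: extension -/

section AlgClosed

variable {L : Type*} [Field L] [Algebra K L]

/-- **Over an algebraically closed field, prime ideals of `K[X_σ]` stay prime in `L[X_σ]`** for
every extension field `L ⊇ K`: `L[X]/Q L[X] ≅ L ⊗_K (K[X]/Q)` is a domain (the product of
integral `K`-schemes is integral for `K` algebraically closed). [cite: GortzWedhorn2020, Prop. 5.51] -/
theorem isPrime_map_of_isAlgClosed [IsAlgClosed K] (Q : Ideal (MvPolynomial σ K)) [Q.IsPrime] :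
    (Q.map (MvPolynomial.map (algebraMap K L))).IsPrime := by
  obtain ⟨e, -⟩ := Literature.FieldTheory.Regular.exists_algEquiv_quotient_map_tensor (F' := L) Q
  haveI : IsDomain (L ⊗[K] (MvPolynomial σ K ⧸ Q)) :=
    Literature.FieldTheory.Regular.isDomain_tensorProduct_of_isAlgClosed K (MvPolynomial σ K ⧸ Q) L
  haveI : IsDomain (MvPolynomial σ L ⧸ Q.map (MvPolynomial.map (algebraMap K L))) :=
    MulEquiv.isDomain (L ⊗[K] (MvPolynomial σ K ⧸ Q)) e.toMulEquiv
  exact (Ideal.Quotient.isDomain_iff_prime _).1 this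

/-- Over an algebraically closed `K`, the extension `Q L[X_σ]` of a minimal prime `Q` over
`J ⊆ K[X_σ]` is a minimal prime over `J L[X_σ]`. [cite: GortzWedhorn2020, Rem. 5.55] -/
theorem map_mem_minimalPrimes_of_isAlgClosed [IsAlgClosed K] (J : Ideal (MvPolynomial σ K))
    {Q : Ideal (MvPolynomial σ K)} (hQ : Q ∈ J.minimalPrimes) :
    Q.map (MvPolynomial.map (algebraMap K L)) ∈
      (J.map (MvPolynomial.map (algebraMap K L))).minimalPrimes := by
  haveI : Q.IsPrime := hQ.1.1
  refine ⟨⟨isPrime_map_of_isAlgClosed Q, Ideal.map_mono hQ.1.2⟩, ?_⟩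
  rintro P ⟨hP, hJP⟩ hPQ
  -- `P ∩ K[X]` is a prime between `J` and `Q`, hence equal to `Q`
  have h1 : P.comap (MvPolynomial.map (algebraMap K L)) ≤ Q := by
    have := Ideal.comap_mono (f := MvPolynomial.map (algebraMap K L)) hPQ
    rwa [comap_map_coeff_eq] at this
  have h2 : J ≤ P.comap (MvPolynomial.map (algebraMap K L)) := Ideal.map_le_iff_le_comap.1 hJP
  have h3 : P.comap (MvPolynomial.map (algebraMap K L)) = Q :=
    le_antisymm h1 (hQ.2 ⟨Ideal.comap_isPrime _ P, h2⟩ h1)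
  calc Q.map (MvPolynomial.map (algebraMap K L))
      = (P.comap (MvPolynomial.map (algebraMap K L))).map (MvPolynomial.map (algebraMap K L)) := by
        rw [h3]
    _ ≤ P := Ideal.map_comap_le

/-- Over an algebraically closed `K`, a minimal prime `P` over `J L[X_σ]` is extended from its
contraction: `P = (P ∩ K[X_σ]) L[X_σ]`. [cite: GortzWedhorn2020, Rem. 5.55] -/
theorem map_comap_eq_of_mem_minimalPrimes_map [IsAlgClosed K] (J : Ideal (MvPolynomial σ K))
    {P : Ideal (MvPolynomial σ L)}
    (hP : P ∈ (J.map (MvPolynomial.map (algebraMap K L))).minimalPrimes) :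
    (P.comap (MvPolynomial.map (algebraMap K L))).map (MvPolynomial.map (algebraMap K L)) = P := by
  haveI : P.IsPrime := hP.1.1
  have hQ := comap_mem_minimalPrimes_of_mem_minimalPrimes_map J hP
  have hmin := map_mem_minimalPrimes_of_isAlgClosed (L := L) J hQ
  exact le_antisymm Ideal.map_comap_le (hP.2 hmin.1 Ideal.map_comap_le)

/-- **Irreducible components do not change under extension of an algebraically closed base
field**: for `K` algebraically closed and `L ⊇ K`, the minimal primes over `J L[X_σ]` are
exactly the extensions of the minimal primes over `J`. [cite: GortzWedhorn2020, Rem. 5.55] -/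
theorem minimalPrimes_map_of_isAlgClosed [IsAlgClosed K] (J : Ideal (MvPolynomial σ K)) :
    (J.map (MvPolynomial.map (algebraMap K L))).minimalPrimes =
      Ideal.map (MvPolynomial.map (algebraMap K L)) '' J.minimalPrimes := by
  ext P
  constructor
  · intro hP
    exact ⟨_, comap_mem_minimalPrimes_of_mem_minimalPrimes_map J hP,
      map_comap_eq_of_mem_minimalPrimes_map J hP⟩
  · rintro ⟨Q, hQ, rfl⟩
    exact map_mem_minimalPrimes_of_isAlgClosed J hQ

/-- Hence the NUMBER of minimal primes (irreducible components) is the same over `K` and over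
`L`. [cite: GortzWedhorn2020, Rem. 5.55] -/
theorem ncard_minimalPrimes_map_of_isAlgClosed [IsAlgClosed K] (J : Ideal (MvPolynomial σ K)) :
    ((J.map (MvPolynomial.map (algebraMap K L))).minimalPrimes).ncard = (J.minimalPrimes).ncard := by
  rw [minimalPrimes_map_of_isAlgClosed, Set.ncard_image_of_injective _ map_coeff_injective]

end AlgClosed

/-- **The geometric number of irreducible components is independent of the algebraically closed
field**: for every algebraically closed extension `L` of `k`,
`geomComponentCount 𝔭 = #minimalPrimes (𝔭 L[X_σ])`. [cite: GortzWedhorn2020, Rem. 5.55] -/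
theorem geomComponentCount_eq_ncard_minimalPrimes_map {L : Type*} [Field L] [Algebra k L]
    [IsAlgClosed L] (𝔭 : Ideal (MvPolynomial σ k)) :
    geomComponentCount 𝔭 =
      ((𝔭.map (MvPolynomial.map (algebraMap k L))).minimalPrimes).ncard := by
  -- embed `k̄` into `L` over `k`
  let ι : AlgebraicClosure k →ₐ[k] L := IsAlgClosed.lift
  letI : Algebra (AlgebraicClosure k) L := ι.toRingHom.toAlgebra
  have hι : algebraMap (AlgebraicClosure k) L = ι.toRingHom := rfl
  have hcomp : (algebraMap k L) = (algebraMap (AlgebraicClosure k) L).comp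
      (algebraMap k (AlgebraicClosure k)) := by
    rw [hι]; ext x; simp
  have hmap : MvPolynomial.map (σ := σ) (algebraMap k L) =
      (MvPolynomial.map (algebraMap (AlgebraicClosure k) L)).comp
        (MvPolynomial.map (algebraMap k (AlgebraicClosure k))) := by
    rw [hcomp]; exact RingHom.ext fun p => (MvPolynomial.map_map _ _ p).symm
  rw [geomComponentCount_def, hmap, ← Ideal.map_map]
  exact (ncard_minimalPrimes_map_of_isAlgClosed (K := AlgebraicClosure k) (L := L) _).symm

/-! ### Components through a rational point -/

section Point

variable {L : Type*} [Field L] [Algebra K L]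

/-- Evaluation at a `K`-point commutes with extension of scalars:
`ev_{y}(pᴸ) = (ev_y p)ᴸ`. [folklore] -/
private theorem aeval_algebraMap_comp_map (y : σ → K) (p : MvPolynomial σ K) :
    MvPolynomial.aeval (algebraMap K L ∘ y) (MvPolynomial.map (algebraMap K L) p) =
      algebraMap K L (MvPolynomial.aeval y p) := by
  rw [aeval_map_algebraMap, aeval_algebraMap_apply]

/-- For `Q ⊆ K[X_σ]` and a point `y ∈ K^σ`: `Q L[X_σ]` vanishes at `y` iff `Q` does, i.e.
`Q L[X_σ] ≤ ker (ev_y)` in `L[X_σ]` iff `Q ≤ ker (ev_y)` in `K[X_σ]`. [folklore] -/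
private theorem map_le_ker_aeval_iff (Q : Ideal (MvPolynomial σ K)) (y : σ → K) :
    Q.map (MvPolynomial.map (algebraMap K L)) ≤
        RingHom.ker (MvPolynomial.aeval (R := L) (algebraMap K L ∘ y)) ↔
      Q ≤ RingHom.ker (MvPolynomial.aeval (R := K) y) := by
  rw [Ideal.map_le_iff_le_comap]
  refine ⟨fun h p hp => ?_, fun h p hp => ?_⟩
  · have h1 := h hp
    rw [Ideal.mem_comap, RingHom.mem_ker, aeval_algebraMap_comp_map] at h1
    rw [RingHom.mem_ker]
    exact (map_eq_zero_iff _ (algebraMap K L).injective).1 h1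
  · have h1 := h hp
    rw [RingHom.mem_ker] at h1
    rw [Ideal.mem_comap, RingHom.mem_ker, aeval_algebraMap_comp_map, h1, map_zero]

/-- **Uniqueness of the irreducible component through a rational point is independent of the
algebraically closed field.** For `K` algebraically closed, `J ⊆ K[X_σ]`, `y ∈ K^σ` and any
extension `L ⊇ K`: exactly one minimal prime of `J L[X_σ]` lies in `𝔪_y` iff exactly one
minimal prime of `J` does (the components correspond by `Q ↦ Q L[X_σ]`,
`minimalPrimes_map_of_isAlgClosed`, and vanishing at `y` is tested over `K`).
[cite: GortzWedhorn2020, Rem. 5.55] -/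
theorem existsUnique_minimalPrimes_map_le_ker_iff [IsAlgClosed K] (J : Ideal (MvPolynomial σ K))
    (y : σ → K) :
    (∃! P : Ideal (MvPolynomial σ L),
        P ∈ (J.map (MvPolynomial.map (algebraMap K L))).minimalPrimes ∧
          P ≤ RingHom.ker (MvPolynomial.aeval (R := L) (algebraMap K L ∘ y))) ↔
      ∃! Q : Ideal (MvPolynomial σ K),
        Q ∈ J.minimalPrimes ∧ Q ≤ RingHom.ker (MvPolynomial.aeval (R := K) y) := by
  constructor
  · rintro ⟨P, ⟨hP, hPy⟩, huniq⟩
    refine ⟨P.comap (MvPolynomial.map (algebraMap K L)),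
      ⟨comap_mem_minimalPrimes_of_mem_minimalPrimes_map J hP, ?_⟩, ?_⟩
    · rw [← map_le_ker_aeval_iff (L := L), map_comap_eq_of_mem_minimalPrimes_map J hP]
      exact hPy
    · rintro Q ⟨hQ, hQy⟩
      have h1 : Q.map (MvPolynomial.map (algebraMap K L)) = P :=
        huniq _ ⟨map_mem_minimalPrimes_of_isAlgClosed J hQ, (map_le_ker_aeval_iff Q y).2 hQy⟩
      rw [← h1, comap_map_coeff_eq]
  · rintro ⟨Q, ⟨hQ, hQy⟩, huniq⟩
    refine ⟨Q.map (MvPolynomial.map (algebraMap K L)),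
      ⟨map_mem_minimalPrimes_of_isAlgClosed J hQ, (map_le_ker_aeval_iff Q y).2 hQy⟩, ?_⟩
    rintro P ⟨hP, hPy⟩
    have h1 : P.comap (MvPolynomial.map (algebraMap K L)) = Q :=
      huniq _ ⟨comap_mem_minimalPrimes_of_mem_minimalPrimes_map J hP, by
        rw [← map_le_ker_aeval_iff (L := L), map_comap_eq_of_mem_minimalPrimes_map J hP]
        exact hPy⟩
    rw [← map_comap_eq_of_mem_minimalPrimes_map J hP, h1]

end Point

end Literature.RingTheory.MvPolynomial

end
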